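import Literature.MathematicalPhysics.QuantumLattice.HubbardSectorPropagatorGram
import HarnessLib

/-!
# The Matsubara-shifted single-scale covariances of the Hubbard torus (complex chemical potential as a frequency shift)

Topic `MathematicalPhysics/QuantumLattice`; companion of `HubbardFreeCovariance.lean` (fields, zero-seed free covariance
`βL²·(iω + ξ)/(ω² + ξ²) = βL²/(-iω + ξ)`, Salmhofer's slices `hubbardCovSlice`) and `HubbardSectorPropagatorGram.lean`
(`normalCovariance p`: every momentum-diagonal charge-paired covariance with symbol `p` has the charge structure and the Gram
form required by the single-scale step).  A complex chemical potential `μ′ = μ + iθ` in the free propagator is the same as a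
REAL SHIFT of the Matsubara frequencies, `1/(-iω + ξ - iθ) = 1/(-i(ω + θ) + ξ)`; for `|θ| ≤ π/(4β) ≤ |ω|/4` every
single-scale bound of the unshifted propagator survives with the constant `4/3`.  This is the covariance family of the
`βU ≤ κ` corner of the Hubbard two-point function (cell gate-hubbard-kl, note R0-SCOPE-2, engine E1): expanding around the
Hartree-shifted chemical potential `μ′ = μ - Uρ₀` with COMPLEX `U` (for the Cauchy estimate of the Taylor coefficients)
puts `θ = -ρ₀ Im U` into the propagator and nowhere else (Benfatto–Giuliani–Mastropietro 2006, §2.1 (2.3) and Remark 5–6: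
the dispersion, not a counterterm, carries the quadratic part).

* `shiftedFreeSymbol β μ θ` — `βL² (i(ω+θ) + ξ)/((ω+θ)² + ξ²)`; `hubbardCovSliceShifted β μ θ Λ Λ′` — the Salmhofer slice
  `(w_Λ - w_{Λ′}) ·` shifted symbol, as a `normalCovariance` (so `pullback_normalCovariance_eq_zero_of_charge_eq`,
  `contr_pullback_normalCovariance_eq_inner`, `norm_sq_sectorGramF/G` apply verbatim);
* `shiftedFreeSymbol_zero`, **`hubbardCovSliceShifted_zero`** — at `θ = 0` these are the tree's zero-seed symbol and
  `hubbardCovSlice β μ 0 Λ Λ′`;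
* (private `sq_add_sq_shift_ge` — `(ω+θ)² + ξ² ≥ (9/16)(ω² + ξ²)` for `|θ| ≤ |ω|/4`;)
  **`norm_shiftedFreeSymbol_le`** — `‖shifted symbol‖ ≤ (4/3) βL²/√(ω² + ξ²)` for `0 < β`, `|θ| ≤ π/(4β)`.

Everything is proved; the two definitions are the only new objects; no named facts.

## Sources

G. Benfatto, A. Giuliani, V. Mastropietro, Ann. Henri Poincaré 7 (2006) 809–898, §2.1 (2.3), §2.2 (2.13), Remarks 5–6
(`BenfattoGiulianiMastropietro2006`); M. Salmhofer, *Renormalization* (1999), §4.2.5 (4.70) (`Salmhofer1999`).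
-/

noncomputable section

namespace Literature.MathematicalPhysics.QuantumLattice

open Literature.Probability.LatticeModels GrassmannAlgebra Finset

variable (L M : ℕ)

/-- The **Matsubara-shifted zero-seed free symbol** `βL² (i(ω + θ) + ξ(k⃗)) / ((ω + θ)² + ξ(k⃗)²) = βL²/(-i(ω+θ) + ξ)`
(the free propagator `ĝ(k) = 1/(-ik₀ + ε(k⃗) - μ′)` of BGM 2006 (2.3) at the complex chemical potential `μ′ = μ + iθ`,
normalised as in `hubbardCovariance_zero_seed`; both spins). [cite: BenfattoGiulianiMastropietro2006, §2.1 (2.3)] -/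
def shiftedFreeSymbol (β μ θ : ℝ) (ks : FreqMomentum L M × Fin 2) : ℂ :=
  ((β * (L : ℝ) ^ 2 : ℝ) : ℂ) *
    ((Complex.I * ((matsubaraFreq β M ks.1.1 + θ : ℝ) : ℂ) + nambuXi L μ ks.1.2) /
      (((matsubaraFreq β M ks.1.1 + θ) ^ 2 + nambuXi L μ ks.1.2 ^ 2 : ℝ) : ℂ))

/-- The **shifted Salmhofer slice** `C^{θ}_{(Λ,Λ′]}`: the normal covariance with symbol `(w_Λ(k) - w_{Λ′}(k)) · βL²/(-i(ω+θ) + ξ)`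
(cutoff weights `χ₂((ω² + ξ²)/Λ²)` of `hubbardCutoffWeight`, unshifted). [cite: Salmhofer1999, §4.2.5 (4.70)] -/
def hubbardCovSliceShifted (β μ θ Λ Λ' : ℝ) : Matrix (HubbardFieldIdx L M) (HubbardFieldIdx L M) ℂ :=
  normalCovariance L M (fun ks =>
    ((hubbardCutoffWeight L M β μ Λ ks.1 : ℂ) - (hubbardCutoffWeight L M β μ Λ' ks.1 : ℂ)) * shiftedFreeSymbol L M β μ θ ks)

variable {L M}

/-- At `θ = 0` the shifted symbol is the tree's zero-seed symbol `βL² (iω + ξ)/(ω² + ξ²)` (BGM 2006, (2.3)).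
[cite: BenfattoGiulianiMastropietro2006, §2.1 (2.3)] -/
theorem shiftedFreeSymbol_zero [NeZero L] (β μ : ℝ) (ks : FreqMomentum L M × Fin 2) :
    shiftedFreeSymbol L M β μ 0 ks =
      ((β * (L : ℝ) ^ 2 : ℝ) : ℂ) * ((Complex.I * matsubaraFreq β M ks.1.1 + nambuXi L μ ks.1.2) / nambuDen L M β μ 0 ks.1) := by
  rw [shiftedFreeSymbol, nambuDen]
  simp only [add_zero, zero_mul, zero_pow two_ne_zero]

/-- **At `θ = 0` the shifted slice is the tree's slice** `hubbardCovSlice β μ 0 Λ Λ′` (Salmhofer's slice (4.70)).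
[cite: Salmhofer1999, §4.2.5 (4.70)] -/
theorem hubbardCovSliceShifted_zero [NeZero L] (β μ Λ Λ' : ℝ) :
    hubbardCovSliceShifted L M β μ 0 Λ Λ' = hubbardCovSlice L M β μ 0 Λ Λ' := by
  rw [hubbardCovSliceShifted, hubbardCovSlice_zero_seed]
  congr 1
  funext ks
  rw [shiftedFreeSymbol_zero]

/-- The shifted slice is antisymmetric (a fermionic covariance, BGM 2006 (2.3)). [cite: BenfattoGiulianiMastropietro2006, §2.1 (2.3)] -/
theorem hubbardCovSliceShifted_transpose [NeZero L] (β μ θ Λ Λ' : ℝ) :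
    (hubbardCovSliceShifted L M β μ θ Λ Λ').transpose = -hubbardCovSliceShifted L M β μ θ Λ Λ' := by
  rw [hubbardCovSliceShifted, normalCovariance_transpose]

/-- The shifted slice vanishes between fields of equal charge (it pairs `ψ⁺` with `ψ⁻` only, BGM 2006 (2.3)).
[cite: BenfattoGiulianiMastropietro2006, §2.1 (2.3)] -/
theorem hubbardCovSliceShifted_apply_of_charge_eq (β μ θ Λ Λ' : ℝ) {X Y : HubbardFieldIdx L M} (h : X.2 = Y.2) :
    hubbardCovSliceShifted L M β μ θ Λ Λ' X Y = 0 := by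
  rw [hubbardCovSliceShifted]
  exact normalCovariance_apply_of_charge_eq _ h

/-- **A quarter-shift costs a factor `16/9`**: `(ω + θ)² + ξ² ≥ (9/16)(ω² + ξ²)` whenever `|θ| ≤ |ω|/4`. [folklore] -/
private theorem sq_add_sq_shift_ge {ω θ ξ : ℝ} (hθ : |θ| ≤ |ω| / 4) :
    9 / 16 * (ω ^ 2 + ξ ^ 2) ≤ (ω + θ) ^ 2 + ξ ^ 2 := by
  have h1 : (3 / 4 * |ω|) ^ 2 ≤ (ω + θ) ^ 2 := by
    have hlow : 3 / 4 * |ω| ≤ |ω + θ| := by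
      have h2 : |ω| - |θ| ≤ |ω + θ| := by
        have := abs_sub_abs_le_abs_sub ω (-θ)
        rw [abs_neg, sub_neg_eq_add] at this
        exact this
      linarith
    have h0 : 0 ≤ 3 / 4 * |ω| := by positivity
    calc (3 / 4 * |ω|) ^ 2 ≤ |ω + θ| ^ 2 := pow_le_pow_left₀ h0 hlow 2
      _ = (ω + θ) ^ 2 := sq_abs _
  have h2 : (3 / 4 * |ω|) ^ 2 = 9 / 16 * ω ^ 2 := by rw [mul_pow, sq_abs]; norm_num
  nlinarith [sq_nonneg ξ]

/-- **The shifted symbol obeys the free bound with constant `4/3`**: for `0 < β` and `|θ| ≤ π/(4β)` (so `|θ| ≤ |ω|/4` for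
every fermionic frequency, `|ω| ≥ π/β`), `‖βL²/(-i(ω+θ) + ξ)‖ ≤ (4/3)·βL²/√(ω² + ξ²)` — every single-scale estimate of the
unshifted slices transfers to the shifted ones. [cite: BenfattoGiulianiMastropietro2006, §2.1 (2.3)] -/
theorem norm_shiftedFreeSymbol_le {β : ℝ} (hβ : 0 < β) (μ : ℝ) {θ : ℝ} (hθ : |θ| ≤ Real.pi / (4 * β))
    (ks : FreqMomentum L M × Fin 2) :
    ‖shiftedFreeSymbol L M β μ θ ks‖ ≤
      4 / 3 * (β * (L : ℝ) ^ 2) / Real.sqrt (matsubaraFreq β M ks.1.1 ^ 2 + nambuXi L μ ks.1.2 ^ 2) := by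
  set ω : ℝ := matsubaraFreq β M ks.1.1 with hω
  set ξ : ℝ := nambuXi L μ ks.1.2 with hξ
  have hωlow : Real.pi / β ≤ |ω| := pi_div_le_abs_matsubaraFreq hβ ks.1.1
  have hθω : |θ| ≤ |ω| / 4 := by
    refine hθ.trans ?_
    rw [div_le_div_iff₀ (by positivity) (by norm_num : (0:ℝ) < 4)]
    have := mul_le_mul_of_nonneg_left hωlow (by norm_num : (0:ℝ) ≤ 4)
    calc Real.pi * 4 = 4 * (Real.pi / β) * β := by field_simp
      _ ≤ 4 * |ω| * β := by nlinarith [abs_nonneg ω]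
      _ = |ω| * (4 * β) := by ring
  have hD := sq_add_sq_shift_ge (ξ := ξ) hθω
  have hωpos : 0 < |ω| := lt_of_lt_of_le (by positivity) hωlow
  have hS0 : 0 < ω ^ 2 + ξ ^ 2 := by
    have : 0 < ω ^ 2 := by rw [← sq_abs]; positivity
    linarith [sq_nonneg ξ]
  have hDpos : 0 < (ω + θ) ^ 2 + ξ ^ 2 := lt_of_lt_of_le (by positivity) hD
  -- `‖(i a + ξ)/(a² + ξ²)‖ = 1/√(a² + ξ²)` with `a = ω + θ`
  have hnum : ‖Complex.I * (((ω + θ : ℝ)) : ℂ) + (ξ : ℂ)‖ = Real.sqrt ((ω + θ) ^ 2 + ξ ^ 2) := by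
    rw [Complex.norm_eq_sqrt_sq_add_sq]
    congr 1
    simp [Complex.add_re, Complex.add_im, Complex.mul_re, Complex.mul_im]
    ring
  have hfrac : ‖(Complex.I * (((ω + θ : ℝ)) : ℂ) + (ξ : ℂ)) / ((((ω + θ) ^ 2 + ξ ^ 2 : ℝ)) : ℂ)‖ =
      1 / Real.sqrt ((ω + θ) ^ 2 + ξ ^ 2) := by
    rw [norm_div, hnum, Complex.norm_real, Real.norm_eq_abs, abs_of_pos hDpos]
    have hs : Real.sqrt ((ω + θ) ^ 2 + ξ ^ 2) ≠ 0 := Real.sqrt_ne_zero'.2 hDpos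
    rw [div_eq_div_iff hDpos.ne' hs, one_mul, ← Real.sqrt_mul_self hDpos.le, Real.sqrt_mul_self hDpos.le,
      Real.mul_self_sqrt hDpos.le]
  have hnorm : ‖shiftedFreeSymbol L M β μ θ ks‖ = β * (L : ℝ) ^ 2 * (1 / Real.sqrt ((ω + θ) ^ 2 + ξ ^ 2)) := by
    rw [shiftedFreeSymbol, norm_mul, Complex.norm_real, Real.norm_eq_abs, abs_of_nonneg (by positivity), ← hω, ← hξ]
    have hcast : (nambuXi L μ ks.1.2 : ℂ) = ((ξ : ℝ) : ℂ) := by rw [hξ]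
    rw [hcast, hfrac]
  rw [hnorm]
  -- compare `1/√((ω+θ)²+ξ²) ≤ (4/3)/√(ω²+ξ²)`
  have hsqrt : 3 / 4 * Real.sqrt (ω ^ 2 + ξ ^ 2) ≤ Real.sqrt ((ω + θ) ^ 2 + ξ ^ 2) := by
    have h34 : 3 / 4 * Real.sqrt (ω ^ 2 + ξ ^ 2) = Real.sqrt (9 / 16 * (ω ^ 2 + ξ ^ 2)) := by
      rw [Real.sqrt_mul (by norm_num), show Real.sqrt (9 / 16 : ℝ) = 3 / 4 by
        rw [show (9 / 16 : ℝ) = (3 / 4) ^ 2 by norm_num, Real.sqrt_sq (by norm_num)]]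
    rw [h34]
    exact Real.sqrt_le_sqrt hD
  have hs1 : 0 < Real.sqrt (ω ^ 2 + ξ ^ 2) := Real.sqrt_pos.2 hS0
  have hs2 : 0 < Real.sqrt ((ω + θ) ^ 2 + ξ ^ 2) := Real.sqrt_pos.2 hDpos
  rw [mul_one_div, div_le_div_iff₀ hs2 hs1]
  have hβL : 0 ≤ β * (L : ℝ) ^ 2 := by positivity
  nlinarith [mul_le_mul_of_nonneg_left hsqrt hβL]

end Literature.MathematicalPhysics.QuantumLattice

end
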